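import Literature.NumberTheory.LFunctions.MertensErrorTermsMeanValueRH
import Literature.NumberTheory.LFunctions.SchoenfeldExplicit
import Literature.Analysis.SpecialFunctions.EulerMascheroniBounds
import HarnessLib

/-!
# RH-CONDITIONAL — Lee–Nosal 2026: `|ψ(x) − x|, |ϑ(x) − x| ≤ √x log x (log x − log log x)/(8π)` and explicit Mertens' theorems, assuming RH («nothing here bears on the truth of RH»)

Topic `Literature/NumberTheory/LFunctions` (RH literature-typing tranche 1, L4 "explicit zero
statistics": explicit prime-number-theorem errors from the zeros, gen 10). Label: **RH-CONDITIONAL** —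
every statement of the source ASSUMES the Riemann Hypothesis (`RiemannHypothesis →`); the hypothesis
is explicit in each named fact. Refereed (J. Number Theory 283 (2026) 241–258; accepted text =
arXiv:2312.05628v4). Three NAMED FACTS (`def … : Prop`, D-0014: nothing asserted, users take
`(h : …)`) and cheap PROVED consequences in the tree's vocabulary. Nothing here bears on the truth of
RH; no endorsement.

Source: E. S. Lee, P. Nosal, *Sharper bounds for the error in the prime number theorem assuming the
Riemann Hypothesis*, J. Number Theory 283 (2026) 241–258 `[corpus:paper:arxiv-2312.05628 p0003
(Thms 1.1–1.2, Cor. 1.3), p0004 (method), p0007–p0009 (§§3.1–3.3)]`. Inputs of the printed proofs: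
Goldston's method made explicit (Thm 1.1, `x > 10¹⁹`), Rosser–Schoenfeld's smoothed explicit formula
(Lemma 3.3), Büthe's RH-free numerical bounds below `10¹⁹` (`|ϑ(x) − x| ≤ 1.95√x` on
`[1423, 10¹⁹]`), the zero sums `Σ 1/|ρ|²` (Brent–Platt–Trudgian 2021, the tree's
`BrentPlattTrudgian2021_cor1`).

What the tree had: Schoenfeld 1976 under RH — `|ψ(x) − x| < √x log²x/(8π)` (`x ≥ 73.2`,
`Schoenfeld1976_psi`), `|ϑ(x) − x| ≤ √x log²x/(8π)` (`x ≥ 599`, `Schoenfeld1976_theta`),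
`(log x − 2) log x` for `x ≥ 23·10⁸` (`Schoenfeld1976_thm10`); von Koch `O(√x log²x)` proved
(`chebyshevPsi_vonKoch_of_RH`). Lee–Nosal replace `log x` by `log x − log log x`.

## Contents

* `LeeNosal2026_thm11` — **Theorem 1.1**: RH ⇒ for `x ≥ 11`,
  `|ψ(x) − x| ≤ √x log x (log x/(8π) − (1/(2π) + 1.465/log x) log log x + 1.2325)`.
* `LeeNosal2026_thm12` — **Theorem 1.2**: RH ⇒ `|ψ(x) − x| ≤ √x log x (log x − log log x)/(8π)`
  for `x ≥ 101` and `|ϑ(x) − x| ≤ √x log x (log x − log log x)/(8π)` for `x ≥ 2657`.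
* `LeeNosal2026_cor13` — **Corollary 1.3** (RH): `|Σ_{p≤x} log p/p − log x − E| ≤ 3 log²x/(8π√x)`
  (`x ≥ 43.1`), `|Σ_{p≤x} 1/p − log log x − B| ≤ 3 log x/(8π√x)` (`x ≥ 24.4`),
  `|e^C log x Π_{p≤x}(1 − 1/p) − 1| ≤ 3 log x/(8π√x)` (`x ≥ 23.8`),
  `|e^{−C}(log x)⁻¹ Π_{p≤x}(1 − 1/p)⁻¹ − 1| ≤ 3 log x/(8π√x)` (`x ≥ 24.2`); `E = rosserSchoenfeldE`
  (`−1.33258…`), `B = Mertens.meisselMertens` (`0.26149…`), `C = γ` (Euler–Mascheroni).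
* PROVED: `LeeNosal2026_thm12.psi_le_schoenfeld / theta_le_schoenfeld` (⇒ Schoenfeld's
  `√x log²x/(8π)` shape on `x ≥ 101` / `x ≥ 2657`), `.abs_psi_sub_le_of_le / abs_theta_sub_le_of_le`
  (monotone reading: any `A ≥ (log x − log log x)/(8π)`), `LeeNosal2026_cor13.E₁_le / E₂_le / E₃_le /
  E₃_le'` (Cor. 1.3 in the `Zhao2025.E₁/E₂/E₃` notation of `MertensErrorTermsMeanValueRH.lean`; the
  third via `E₃ = e^{γ}(e^{−γ}(log x)⁻¹Π(1−1/p)⁻¹ − 1)` and `e^γ ≤ 1.7811`).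

NOT typed: Lemma 3.3 (the smoothed explicit-formula inequality, an intermediate display), the
remark that Thm 1.1 is stronger than Thm 1.2 exactly for `x ≥ e^{30369.58…}`.

KERNEL STATUS (2026-08-27). `LeeNosal2026_thm11` and `LeeNosal2026_thm12` are THEOREMS modulo
Büthe's unconditional computer-assisted bounds below `10¹⁹` (the same inputs the source uses there):
`LeeNosalThm11.LeeNosal2026_thm11_of_buthe : Buthe2018_thm2_psi → LeeNosal2026_thm11`
(`PrimeNumberTheoremErrorRHExplicitThm11.lean`) and
`LeeNosal2026_thm12_of_buthe : Buthe2018_thm2_psi → Buthe2018_thm2_theta → LeeNosal2026_thm12`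
(`PrimeNumberTheoremErrorRHExplicitPsiWindow.lean`). Ingredients: for large `x` the tree's RH
machinery behind Schoenfeld's Theorem 10 (the differenced explicit formula
`SchoenfeldBound.psi_sub_self_le`/`neg_le_psi_sub_self` with the `2000` certified zeros) run with
`T = 2π√x/log x`, `h = √x log x/π` — `LeeNosalThm12.psi_large` (RH ⇒ Thm 1.2 (`ψ`) for `x ≥ 10¹⁰`),
`LeeNosalThm12.theta_large` (`θ`, `x ≥ 10¹⁴`), `LeeNosalThm11.abs_psi_sub_le_bound₁_of_exp_le`
(Thm 1.1, `x ≥ e²³`), all in `PrimeNumberTheoremErrorRHExplicitProofs.lean`; Büthe's `0.94√x`/`1.95√x`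
on `[350, 10¹⁹]`/`[3500, 10¹⁹]`; and kernel certificates for the windows `101 ≤ x < 353` (`ψ`,
`LeeNosalPsiChain.abs_psi_sub_le_window`) and `2657 ≤ x ≤ 3511` (`θ`,
`LeeNosalThetaChain.abs_theta_sub_le_window`, `…ThetaWindow.lean`), both RH-free.
`LeeNosal2026_cor13` is not attempted (partial summation + numerical integration below `10¹⁹`).

## References

* E. S. Lee, P. Nosal, J. Number Theory 283 (2026) 241–258 = arXiv:2312.05628v4, Thms 1.1–1.2,
  Cor. 1.3. [LeeNosal2026]
* L. Schoenfeld, Math. Comp. 30 (1976) 337–360, Thm. 10. [Schoenfeld1976]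
* J. Büthe, Math. Comp. 87 (2018) 1991–2009, Thm. 2 (RH-free bounds below `10¹⁹`). [Buthe2018]
* J. B. Rosser, L. Schoenfeld, Illinois J. Math. 6 (1962) 64–94, (2.10)–(2.11) (the constant `E`).
  [RosserSchoenfeld1962]
-/

noncomputable section

open Real Filter
open scoped Chebyshev

namespace Literature.NumberTheory.LFunctions

/-! ## The source's bound functions -/

namespace LeeNosal2026

/-- The right-hand side of Theorem 1.2: `𝓑(x) = √x log x (log x − log log x)/(8π)`.
[cite: LeeNosal2026, Thm. 1.2] -/
def bound (x : ℝ) : ℝ := √x * Real.log x * (Real.log x - Real.log (Real.log x)) / (8 * π)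

/-- The right-hand side of Theorem 1.1:
`𝓑₁(x) = √x log x (log x/(8π) − (1/(2π) + 1.465/log x) log log x + 1.2325)`.
[cite: LeeNosal2026, Thm. 1.1] -/
def bound₁ (x : ℝ) : ℝ :=
  √x * Real.log x *
    (Real.log x / (8 * π) - (1 / (2 * π) + 1.465 / Real.log x) * Real.log (Real.log x) + 1.2325)

/-- Unfolding lemma for `bound`. [cite: LeeNosal2026, Thm. 1.2] -/
theorem bound_def (x : ℝ) :
    bound x = √x * Real.log x * (Real.log x - Real.log (Real.log x)) / (8 * π) := rfl

/-- Unfolding lemma for `bound₁`. [cite: LeeNosal2026, Thm. 1.1] -/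
theorem bound₁_def (x : ℝ) :
    bound₁ x = √x * Real.log x *
      (Real.log x / (8 * π) - (1 / (2 * π) + 1.465 / Real.log x) * Real.log (Real.log x) + 1.2325) :=
  rfl

end LeeNosal2026

/-! ## Named facts -/

/-- NAMED FACT (**Lee–Nosal 2026, Theorem 1.1**, as printed: "If the RH is true and `x ≥ 11`, then
`|ψ(x) − x| ≤ √x log x (log x/(8π) − (1/(2π) + 1.465/log x) log log x + 1.2325)`"; proof: Goldston's
method made explicit for `x > 10¹⁹`, Büthe's computations below). `ψ = Chebyshev.psi`.
**RH-CONDITIONAL** (hypothesis explicit). Users take `(h : LeeNosal2026_thm11)`.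
[cite: LeeNosal2026, Thm. 1.1] -/
def LeeNosal2026_thm11 : Prop :=
  RiemannHypothesis → ∀ x : ℝ, 11 ≤ x → |ψ x - x| ≤ LeeNosal2026.bound₁ x

/-- NAMED FACT (**Lee–Nosal 2026, Theorem 1.2**, as printed: "If the RH is true, then
`|ψ(x) − x| ≤ √x log x (log x − log log x)/(8π)` for all `x ≥ 101`,
`|ϑ(x) − x| ≤ √x log x (log x − log log x)/(8π)` for all `x ≥ 2657`"; proof: Thm 1.1 and the
Rosser–Schoenfeld smoothed explicit formula (Lemma 3.3) for `x ≥ 10¹⁹`, Büthe's RH-free bounds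
below). `ψ = Chebyshev.psi`, `ϑ = Chebyshev.theta`. **RH-CONDITIONAL**. Users take
`(h : LeeNosal2026_thm12)`. [cite: LeeNosal2026, Thm. 1.2] -/
def LeeNosal2026_thm12 : Prop :=
  RiemannHypothesis →
    (∀ x : ℝ, 101 ≤ x → |ψ x - x| ≤ LeeNosal2026.bound x) ∧
      (∀ x : ℝ, 2657 ≤ x → |θ x - x| ≤ LeeNosal2026.bound x)

/-- NAMED FACT (**Lee–Nosal 2026, Corollary 1.3**, as printed: "If the RH is true, then
`|Σ_{p≤x} log p/p − log x − E| ≤ 3(log x)²/(8π√x)` for all `x ≥ 43.1`,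
`|Σ_{p≤x} 1/p − log log x − B| ≤ 3 log x/(8π√x)` for all `x ≥ 24.4`,
`|e^C log x Π_{p≤x}(1 − 1/p) − 1| ≤ 3 log x/(8π√x)` for all `x ≥ 23.8`,
`|(e^{−C}/log x) Π_{p≤x}(1 − 1/p)^{−1} − 1| ≤ 3 log x/(8π√x)` for all `x ≥ 24.2`", with
`B = 0.26149…`, `C = 0.57721…`, `E = −1.33258…`). In the tree's vocabulary: sums/products over
`Nat.primesLE ⌊x⌋₊`, `Σ log p/p = Mertens.primeLogDivSum x`, `Σ 1/p = Mertens.primeRecipSum x`,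
`E = rosserSchoenfeldE`, `B = Mertens.meisselMertens`, `C = Real.eulerMascheroniConstant`.
**RH-CONDITIONAL**. Users take `(h : LeeNosal2026_cor13)`. [cite: LeeNosal2026, Cor. 1.3] -/
def LeeNosal2026_cor13 : Prop :=
  RiemannHypothesis →
    (∀ x : ℝ, 43.1 ≤ x →
        |Mertens.primeLogDivSum x - Real.log x - rosserSchoenfeldE| ≤
          3 * Real.log x ^ 2 / (8 * π * √x)) ∧
    (∀ x : ℝ, 24.4 ≤ x →
        |Mertens.primeRecipSum x - Real.log (Real.log x) - Mertens.meisselMertens| ≤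
          3 * Real.log x / (8 * π * √x)) ∧
    (∀ x : ℝ, 23.8 ≤ x →
        |Real.exp Real.eulerMascheroniConstant * Real.log x *
              ∏ p ∈ Nat.primesLE ⌊x⌋₊, (1 - (p : ℝ)⁻¹) - 1| ≤
          3 * Real.log x / (8 * π * √x)) ∧
    (∀ x : ℝ, 24.2 ≤ x →
        |Real.exp (-Real.eulerMascheroniConstant) / Real.log x *
              ∏ p ∈ Nat.primesLE ⌊x⌋₊, (1 - (p : ℝ)⁻¹)⁻¹ - 1| ≤
          3 * Real.log x / (8 * π * √x))

/-! ## Elementary consequences (proved) -/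

/-- For `x ≥ e`, `log log x ≥ 0`, so `𝓑(x) ≤ √x log²x/(8π)` (Schoenfeld's 1976 shape).
[cite: LeeNosal2026, Thm. 1.2] [cite: Schoenfeld1976, Thm. 10 (6.2)] -/
theorem LeeNosal2026.bound_le_schoenfeld {x : ℝ} (hx : Real.exp 1 ≤ x) :
    LeeNosal2026.bound x ≤ √x * Real.log x ^ 2 / (8 * π) := by
  have hlog1 : 1 ≤ Real.log x := by
    rw [← Real.log_exp 1]; exact Real.log_le_log (Real.exp_pos 1) hx
  have hll : 0 ≤ Real.log (Real.log x) := Real.log_nonneg hlog1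
  have hs : 0 ≤ √x * Real.log x := mul_nonneg (Real.sqrt_nonneg x) (by linarith)
  unfold LeeNosal2026.bound
  rw [div_le_div_iff_of_pos_right (by positivity)]
  nlinarith [mul_nonneg hs hll]

/-- `𝓑` is the value at `A = (log x − log log x)/(8π)` of `A ↦ √x log x · A`; any larger `A` also
bounds. [cite: LeeNosal2026, Thm. 1.2] -/
theorem LeeNosal2026.bound_le_of_le {x A : ℝ} (hx : 1 ≤ x)
    (hA : (Real.log x - Real.log (Real.log x)) / (8 * π) ≤ A) :
    LeeNosal2026.bound x ≤ √x * Real.log x * A := by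
  have hs : 0 ≤ √x * Real.log x := mul_nonneg (Real.sqrt_nonneg x) (Real.log_nonneg hx)
  have : LeeNosal2026.bound x = √x * Real.log x * ((Real.log x - Real.log (Real.log x)) / (8 * π)) := by
    unfold LeeNosal2026.bound; ring
  rw [this]
  exact mul_le_mul_of_nonneg_left hA hs

namespace LeeNosal2026_thm12

/-- **RH ⇒ `|ψ(x) − x| ≤ √x log²x/(8π)` for `x ≥ 101`** (Theorem 1.2 implies Schoenfeld's (6.2)
shape on its range). [cite: LeeNosal2026, Thm. 1.2] [cite: Schoenfeld1976, Thm. 10 (6.2)] -/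
theorem psi_le_schoenfeld (h : LeeNosal2026_thm12) (hRH : RiemannHypothesis) {x : ℝ} (hx : 101 ≤ x) :
    |ψ x - x| ≤ √x * Real.log x ^ 2 / (8 * π) := by
  have he : Real.exp 1 ≤ x := le_trans (le_of_lt (lt_trans Real.exp_one_lt_d9 (by norm_num))) hx
  exact ((h hRH).1 x hx).trans (LeeNosal2026.bound_le_schoenfeld he)

/-- **RH ⇒ `|ϑ(x) − x| ≤ √x log²x/(8π)` for `x ≥ 2657`** (Theorem 1.2 implies the tree's
`Schoenfeld1976_theta` shape on `x ≥ 2657`). [cite: LeeNosal2026, Thm. 1.2] [cite: Schoenfeld1976, Thm. 10 (6.3)] -/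
theorem theta_le_schoenfeld (h : LeeNosal2026_thm12) (hRH : RiemannHypothesis) {x : ℝ}
    (hx : 2657 ≤ x) : |θ x - x| ≤ √x * Real.log x ^ 2 / (8 * π) := by
  have he : Real.exp 1 ≤ x := le_trans (le_of_lt (lt_trans Real.exp_one_lt_d9 (by norm_num))) hx
  exact ((h hRH).2 x hx).trans (LeeNosal2026.bound_le_schoenfeld he)

/-- Monotone reading of the `ψ`-clause: RH, `x ≥ 101`, `(log x − log log x)/(8π) ≤ A` ⇒
`|ψ(x) − x| ≤ √x log x · A`. [cite: LeeNosal2026, Thm. 1.2] -/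
theorem abs_psi_sub_le_of_le (h : LeeNosal2026_thm12) (hRH : RiemannHypothesis) {x A : ℝ}
    (hx : 101 ≤ x) (hA : (Real.log x - Real.log (Real.log x)) / (8 * π) ≤ A) :
    |ψ x - x| ≤ √x * Real.log x * A :=
  ((h hRH).1 x hx).trans (LeeNosal2026.bound_le_of_le (by linarith) hA)

/-- Monotone reading of the `ϑ`-clause: RH, `x ≥ 2657`, `(log x − log log x)/(8π) ≤ A` ⇒
`|ϑ(x) − x| ≤ √x log x · A`. [cite: LeeNosal2026, Thm. 1.2] -/
theorem abs_theta_sub_le_of_le (h : LeeNosal2026_thm12) (hRH : RiemannHypothesis) {x A : ℝ}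
    (hx : 2657 ≤ x) (hA : (Real.log x - Real.log (Real.log x)) / (8 * π) ≤ A) :
    |θ x - x| ≤ √x * Real.log x * A :=
  ((h hRH).2 x hx).trans (LeeNosal2026.bound_le_of_le (by linarith) hA)

end LeeNosal2026_thm12

namespace LeeNosal2026_cor13

/-- Corollary 1.3 (first line) in the notation `E₁(x) = Σ_{p≤x} log p/p − log x − E` of
`MertensErrorTermsMeanValueRH.lean`: RH ⇒ `|E₁(x)| ≤ 3 log²x/(8π√x)` for `x ≥ 43.1`.
[cite: LeeNosal2026, Cor. 1.3] -/
theorem E₁_le (h : LeeNosal2026_cor13) (hRH : RiemannHypothesis) {x : ℝ} (hx : 43.1 ≤ x) :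
    |Zhao2025.E₁ x| ≤ 3 * Real.log x ^ 2 / (8 * π * √x) :=
  (h hRH).1 x hx

/-- Corollary 1.3 (second line) in the notation `E₂(x) = Σ_{p≤x} 1/p − log log x − B`:
RH ⇒ `|E₂(x)| ≤ 3 log x/(8π√x)` for `x ≥ 24.4`. [cite: LeeNosal2026, Cor. 1.3] -/
theorem E₂_le (h : LeeNosal2026_cor13) (hRH : RiemannHypothesis) {x : ℝ} (hx : 24.4 ≤ x) :
    |Zhao2025.E₂ x| ≤ 3 * Real.log x / (8 * π * √x) :=
  (h hRH).2.1 x hx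

/-- Corollary 1.3 (fourth line) in the notation `E₃(x) = (log x)⁻¹ Π_{p≤x}(1 − 1/p)⁻¹ − e^γ`:
since `E₃(x) = e^γ · (e^{−γ}(log x)⁻¹ Π(1 − 1/p)⁻¹ − 1)`, RH ⇒ `|E₃(x)| ≤ e^γ · 3 log x/(8π√x)`
for `x ≥ 24.2`. [cite: LeeNosal2026, Cor. 1.3] -/
theorem E₃_le (h : LeeNosal2026_cor13) (hRH : RiemannHypothesis) {x : ℝ} (hx : 24.2 ≤ x) :
    |Zhao2025.E₃ x| ≤ Real.exp Real.eulerMascheroniConstant * (3 * Real.log x / (8 * π * √x)) := by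
  have h4 := (h hRH).2.2.2 x hx
  set γ := Real.eulerMascheroniConstant with hγ
  set P := ∏ p ∈ Nat.primesLE ⌊x⌋₊, (1 - (p : ℝ)⁻¹)⁻¹ with hP
  have heγ : 0 < Real.exp γ := Real.exp_pos γ
  have hE : Zhao2025.E₃ x = Real.exp γ * (Real.exp (-γ) / Real.log x * P - 1) := by
    have h1 : Real.exp γ * Real.exp (-γ) = 1 := by rw [← Real.exp_add, add_neg_cancel, Real.exp_zero]
    unfold Zhao2025.E₃
    rw [← hP]
    calc P / Real.log x - Real.exp γ
        = (Real.exp γ * Real.exp (-γ)) * P / Real.log x - Real.exp γ := by rw [h1, one_mul]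
      _ = Real.exp γ * (Real.exp (-γ) / Real.log x * P - 1) := by ring
  rw [hE, abs_mul, abs_of_pos heγ]
  exact mul_le_mul_of_nonneg_left h4 heγ.le

/-- Numerical form of the previous bound: `e^γ ≤ 1.7811` (`γ < 0.57721571`, the tree's
`eulerMascheroniConstant_lt_d8`), so RH ⇒ `|E₃(x)| ≤ 1.7811 · 3 log x/(8π√x)` for `x ≥ 24.2`.
[cite: LeeNosal2026, Cor. 1.3] -/
theorem E₃_le' (h : LeeNosal2026_cor13) (hRH : RiemannHypothesis) {x : ℝ} (hx : 24.2 ≤ x) :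
    |Zhao2025.E₃ x| ≤ 1.7811 * (3 * Real.log x / (8 * π * √x)) := by
  have h1 := E₃_le h hRH hx
  have hx1 : 1 ≤ x := by linarith
  have hnn : 0 ≤ 3 * Real.log x / (8 * π * √x) := by
    have := Real.log_nonneg hx1
    positivity
  have hγ : Real.eulerMascheroniConstant < 0.57721571 :=
    Literature.Analysis.SpecialFunctions.Real.eulerMascheroniConstant_lt_d8
  have he : Real.exp Real.eulerMascheroniConstant ≤ 1.7811 := by
    refine (Real.exp_le_exp.2 hγ.le).trans ?_
    have hb := Real.exp_bound' (x := (0.57721571 : ℝ)) (by norm_num) (by norm_num) (n := 10)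
      (by norm_num)
    refine hb.trans ?_
    norm_num [Finset.sum_range_succ, Nat.factorial]
  exact h1.trans (mul_le_mul_of_nonneg_right he hnn)

end LeeNosal2026_cor13

end Literature.NumberTheory.LFunctions

end
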